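import Literature.MathematicalPhysics.KineticTheory.InfiniteChainCurrentPositiveType
import Literature.MathematicalPhysics.KineticTheory.InfiniteChainShiftInvariantUniqueness
import Literature.MathematicalPhysics.KineticTheory.InfiniteChainCurrentMoments
import Literature.MathematicalPhysics.KineticTheory.InfiniteChainGoodSetSymmetries
import HarnessLib

/-!
# Stub CA `stub_absCurrentCorrelation_le` of line `Sketch`, crux `EmbeddedDrudeMourre.DrudeDissolution`
(stmt-AtomisticToContinuum-12593): the stationarity bound `|C_T(t)| ≤ C_T(0)` for every good triple

Half of `StationaryCorrelationBound` (item stmt-AtomisticToContinuum-3435 of route `KineticCorner`).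
For the pinned anharmonic chain `pinnedChain ω₂ lam β γ` (all parameters `> 0`), every `T > 0`, every
DLR state `μ` at `T` invariant under the unit shift, and every `μ`-preserving dynamics `D` whose flow
commutes with the unit shift everywhere and whose summed current correlations converge absolutely at
every time: `|C_T(t)| ≤ C_T(0)` for all `t`, where `C_T = D.currentCorrelation μ`.

The heavy lifting is in the tree (`InfiniteChainDynamics.currentCorrelation_positiveType`: Fejér
representation `C_T = lim n⁻¹ ∫ J_n (J_n ∘ φ_t) dμ`, each approximant bounded by its value at `0`).
Here we only discharge its hypotheses for `P = pinnedChain ω₂ lam β γ`: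
* shift invariance of `μ` IS the `MeasurePreserving` hypothesis for the unit shift (`map_eq`);
* the shift-invariant DLR state is superstable
  (`OscillatorChain.hasSuperstabilityEstimate_of_isShiftInvariant_pinnedChain`);
* `U ≥ 0` measurable, `V` an even non-negative polynomial of degree `4 = 2·2`
  (`pinnedChain_U_nonneg`, `measurable_pinnedChain_U`, `pinnedChain_isEvenPolyOfDegree_V`);
* pointwise covariance of the flow under the unit shift iterates (induction on `x : ℤ`, the case
  `x = -1` by applying the hypothesis at `τ_{-1} σ`) to pointwise — hence a.e. — covariance under
  every lattice translation `chainShift x`.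

## Contents
* `absCurrentCorrelation_flow_chainShift_of_unitShift` — pointwise covariance under `τ_1` gives
  pointwise covariance under every `τ_x`, `x ∈ ℤ`;
* `stub_absCurrentCorrelation_le` — the registered stub, verbatim.
-/

noncomputable section

open MeasureTheory Filter Set

namespace Summit.AtomisticToContinuum.FouriersLaw.Theorems.DrudeDissolution.LineSketch

open Literature.MathematicalPhysics.KineticTheory.HeatConduction

/-- **Pointwise covariance under the unit shift iterates to every lattice translation.** If the flow
of `D` commutes everywhere with `τ_1 = chainShift 1` (`(τ_1 σ)_i = σ_{i+1}`), then it commutes everywhere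
with every `τ_x = chainShift x`, `x ∈ ℤ` (induction on `x`; for `x = -1` apply the hypothesis at
`τ_{-1} σ` and use `τ_1 ∘ τ_{-1} = id = τ_{-1} ∘ τ_1`). [folklore] -/
theorem absCurrentCorrelation_flow_chainShift_of_unitShift {P : OscillatorChain}
    (D : InfiniteChainDynamics P)
    (hcov : ∀ (t : ℝ) (σ : ChainConfig),
      D.flow t (fun i : ℤ => σ (i + 1)) = fun i : ℤ => D.flow t σ (i + 1))
    (x : ℤ) (t : ℝ) (σ : ChainConfig) :
    D.flow t (chainShift x σ) = chainShift x (D.flow t σ) := by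
  -- the hypothesis, in terms of `chainShift 1`
  have hcov1 : ∀ (t : ℝ) (σ : ChainConfig),
      D.flow t (chainShift 1 σ) = chainShift 1 (D.flow t σ) := fun t σ => hcov t σ
  -- the inverse unit shift
  have hneg : ∀ (t : ℝ) (σ : ChainConfig),
      D.flow t (chainShift (-1) σ) = chainShift (-1) (D.flow t σ) := by
    intro t σ
    have h := hcov1 t (chainShift (-1) σ)
    rw [← chainShift.apply_add, add_neg_cancel, chainShift.apply_zero] at h
    rw [h, ← chainShift.apply_add, neg_add_cancel, chainShift.apply_zero]
  revert t σ
  induction x using Int.induction_on with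
  | zero =>
      intro t σ
      rw [chainShift.apply_zero, chainShift.apply_zero]
  | succ n ih =>
      intro t σ
      rw [chainShift.apply_add, ih, hcov1, ← chainShift.apply_add]
  | pred n ih =>
      intro t σ
      rw [sub_eq_add_neg, chainShift.apply_add, ih, hneg, ← chainShift.apply_add]

/-- **CA `stub_absCurrentCorrelation_le` — STATIONARITY BOUND `|C_T(t)| ≤ C_T(0)` FOR EVERY GOOD TRIPLE.**
For `pinnedChain ω₂ lam β γ` (all `> 0`), every `T > 0`, every DLR state `μ` at `T` invariant under the unit
shift and every `μ`-preserving dynamics `D` whose flow commutes with the unit shift everywhere and whose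
summed current correlations converge absolutely at every time: `|C_T(t)| ≤ C_T(0)` for all `t`.
`μ` is THE shift-invariant DLR state, hence superstable (`hasSuperstabilityEstimate_of_isShiftInvariant_pinnedChain`);
pointwise covariance for the unit shift iterates to a.e. covariance for every `chainShift x`
(`absCurrentCorrelation_flow_chainShift_of_unitShift`); then the tree's
`InfiniteChainDynamics.currentCorrelation_positiveType` (Fejér representation `C_T = lim n⁻¹∫J_n(J_n∘φ_t)`,
each approximant bounded by its value at `0`). [folklore] -/
theorem stub_absCurrentCorrelation_le :
    ∀ ω₂ lam β γ : ℝ, 0 < ω₂ → 0 < lam → 0 < β → 0 < γ →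
      ∀ (T : ℝ) (μ : MeasureTheory.Measure Literature.MathematicalPhysics.KineticTheory.HeatConduction.ChainConfig)
        (D : Literature.MathematicalPhysics.KineticTheory.HeatConduction.InfiniteChainDynamics
          (Literature.MathematicalPhysics.KineticTheory.HeatConduction.pinnedChain ω₂ lam β γ)),
        0 < T →
        (Literature.MathematicalPhysics.KineticTheory.HeatConduction.pinnedChain ω₂ lam β γ).IsChainGibbsMeasure T μ →
        D.PreservesMeasure μ →
        (∀ t : ℝ, D.HasAbsConvergentCorrelation μ t) →
        MeasureTheory.MeasurePreserving
          (fun σ : Literature.MathematicalPhysics.KineticTheory.HeatConduction.ChainConfig => fun i : ℤ => σ (i + 1)) μ μ →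
        (∀ (t : ℝ) (σ : Literature.MathematicalPhysics.KineticTheory.HeatConduction.ChainConfig),
          D.flow t (fun i : ℤ => σ (i + 1)) = fun i : ℤ => D.flow t σ (i + 1)) →
        ∀ t : ℝ, |D.currentCorrelation μ t| ≤ D.currentCorrelation μ 0 := by
  intro ω₂ lam β γ hω hl hβ _hγ T μ D hT hG hP hA hshift hcov t
  -- (1) shift invariance of `μ` is the `MeasurePreserving` hypothesis for the unit shift
  have hShiftInv : IsShiftInvariant μ := hshift.map_eq
  -- (2) the shift-invariant DLR state of the pinned chain is superstable
  have hss : (pinnedChain ω₂ lam β γ).HasSuperstabilityEstimate μ :=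
    OscillatorChain.hasSuperstabilityEstimate_of_isShiftInvariant_pinnedChain γ hω hl.le hβ.le hT hG
      hShiftInv
  -- (4) a.e. covariance under every lattice translation
  have hcomm : ∀ (t : ℝ) (x : ℤ), D.flow t ∘ chainShift x =ᵐ[μ] chainShift x ∘ D.flow t :=
    fun t x => Eventually.of_forall fun σ =>
      absCurrentCorrelation_flow_chainShift_of_unitShift D hcov x t σ
  -- (3) + (5) the tree's positive-type theorem
  exact (D.currentCorrelation_positiveType hss one_le_two
    (OscillatorChain.pinnedChain_U_nonneg β γ hω.le hl.le)
    (OscillatorChain.measurable_pinnedChain_U ω₂ lam β γ)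
    (OscillatorChain.pinnedChain_isEvenPolyOfDegree_V ω₂ lam γ hβ) hP hShiftInv hcomm hA).2.1 t

end Summit.AtomisticToContinuum.FouriersLaw.Theorems.DrudeDissolution.LineSketch

end
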